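import Literature.Analysis.FunctionSpaces.DuBoisReymondAE
import HarnessLib

/-!
# The energy identity `|a(t)|² = |a₀|² + 2 Re ∫₀ᵗ ā a'` for primitives of integrable functions

Analysis/FunctionSpaces support file (one-dimensional, in time). It serves the discharge of the
energy inequality for weak solutions of the passive scalar equation
(`Literature.Analysis.FluidPDE.Torus.IsWeakScalarTransportOn.lintegral_sq_add_le`, `FluidPDE/PassiveScalar`), where each
Fourier mode `a(t) = θ̂(t, k)` of a weak solution is shown to satisfy an integral equation
`a(t) = a₀ + ∫_{(0,t]} b` for a.e. `t`, with `b = -λ a - g ∈ L¹(0,T; ℂ)`; the present file turns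
such an integral equation into the modewise energy balance without ever differentiating `a`
(which is only defined almost everywhere):

* `Literature.Analysis.FunctionSpaces.norm_sq_add_setIntegral_eq` — **chain rule for `|primitive|²`, complex form**: for `b`
  integrable on `(a, t]` and `a₀ ∈ ℂ`,
  `‖a₀ + ∫_{(a,t]} b‖² = ‖a₀‖² + 2 Re ∫_{(a,t]} conj(a₀ + ∫_{(a,s]} b) b(s) ds`
  (real and imaginary parts separately are the tree's Fubini-on-a-triangle identity
  `Literature.Analysis.FunctionSpaces.sq_setIntegral_eq_two_mul`);
* `Literature.Analysis.FunctionSpaces.ae_norm_sq_eq_of_ae_eq_add_setIntegral` — the same for a function `a` that agrees a.e. on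
  `(0, T)` with the primitive: `‖a t‖² = ‖a₀‖² + 2 Re ∫_{(0,t]} conj(a) b` for a.e. `t ∈ (0,T)`;
* `Literature.Analysis.FunctionSpaces.ae_norm_sq_add_eq_of_damped`, `Literature.Analysis.FunctionSpaces.ae_norm_sq_add_mul_setIntegral_le_of_damped` — the linearly
  damped case `b = -λ a - g`, `λ ≥ 0`:
  `‖a t‖² + 2λ ∫_{(0,t]} ‖a‖² = ‖a₀‖² - 2 Re ∫_{(0,t]} conj(a) g` for a.e. `t`, and, for `λ > 0` and
  `g ∈ L²(0,T)`, the bound `λ ∫_{(0,t]} ‖a‖² ≤ ‖a₀‖² + λ⁻¹ ∫_{(0,t]} ‖g‖²` (Young, Mathlib's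
  `two_mul_le_add_mul_sq`).

This is the scalar (one Fourier mode) instance of the classical energy equality for parabolic
evolution equations, `d/dt |u|² = 2⟨u', u⟩` for `u ∈ L²(0,T;V)`, `u' ∈ L²(0,T;V')`
(Temam 1984, Ch. III, Lemma 1.2; Evans 2010, §5.9.2, Thm. 3), in the elementary form where the
mode is an honest primitive.

## Mathlib search

Mathlib (this pin) has the fundamental theorem of calculus for everywhere-differentiable
primitives (`intervalIntegral.integral_eq_sub_of_hasDerivAt`) and continuity of primitives
(`intervalIntegral.continuousOn_primitive`), but no chain rule / integration by parts for
primitives of merely integrable functions (searched `integral_mul_deriv`, `sq_integral`,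
`AbsolutelyContinuous` + `integral_deriv`); the tree supplies the triangle identity
`Literature.Analysis.FunctionSpaces.setIntegral_mul_setIntegral_add_symm` / `Literature.Analysis.FunctionSpaces.sq_setIntegral_eq_two_mul` (`DuBoisReymondAE`).

## References

* R. Temam, *Navier–Stokes Equations*, 3rd ed. (North-Holland 1984), Ch. III, §1.1, Lemma 1.2.
* L. C. Evans, *Partial Differential Equations*, 2nd ed. (AMS 2010), §5.9.2 Thm. 3, §7.1.2
  Thm. 2 (energy estimates).
-/

noncomputable section

open MeasureTheory Set Filter Topology
open scoped ComplexConjugate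

namespace Literature.Analysis.FunctionSpaces

/-! ### The primitive of an integrable complex function on `(a, t]` -/

section Primitive

variable {E : Type*} [NormedAddCommGroup E] [NormedSpace ℝ E] {a t : ℝ}

/-- The primitive `s ↦ ∫_{(a,s]} f` of a function integrable on `(a, t]` is continuous on
`[a, t]` (Mathlib's `intervalIntegral.continuousOn_primitive`). [folklore] -/
theorem continuousOn_setIntegral_Ioc {f : ℝ → E} (hf : IntegrableOn f (Ioc a t)) :
    ContinuousOn (fun s => ∫ r in Ioc a s, f r) (Icc a t) :=
  intervalIntegral.continuousOn_primitive ((integrableOn_Icc_iff_integrableOn_Ioc (by simp)).2 hf)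

/-- The primitive of a function integrable on `(a, t]` is bounded on `[a, t]`. [folklore] -/
theorem exists_norm_setIntegral_Ioc_le {f : ℝ → E} (hf : IntegrableOn f (Ioc a t)) :
    ∃ C, ∀ s ∈ Icc a t, ‖∫ r in Ioc a s, f r‖ ≤ C :=
  isCompact_Icc.exists_bound_of_continuousOn (continuousOn_setIntegral_Ioc hf)

variable {b : ℝ → ℂ}

/-- Integrability of `f(s) ∫_{(a,s]} g` on `(a, t]` for real `f, g` integrable on `(a, t]` (an
integrable factor times a bounded continuous one). [folklore] -/
theorem integrableOn_mul_setIntegral_Ioc {f g : ℝ → ℝ} (hf : IntegrableOn f (Ioc a t))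
    (hg : IntegrableOn g (Ioc a t)) :
    IntegrableOn (fun s => f s * ∫ r in Ioc a s, g r) (Ioc a t) := by
  obtain ⟨C, hC⟩ := isCompact_Icc.exists_bound_of_continuousOn (continuousOn_setIntegral_Ioc hg)
  have hcont : ContinuousOn (fun s => ∫ r in Ioc a s, g r) (Ioc a t) :=
    (continuousOn_setIntegral_Ioc hg).mono Ioc_subset_Icc_self
  have h := Integrable.bdd_mul (c := C) hf (hcont.aestronglyMeasurable measurableSet_Ioc)
    (by
      filter_upwards [ae_restrict_mem measurableSet_Ioc] with s hs
      exact hC s (Ioc_subset_Icc_self hs))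
  exact h.congr (Eventually.of_forall fun s => mul_comm _ _)

/-- Integrability of `conj(a₀ + ∫_{(a,s]} b) b(s)` on `(a, t]` (bounded continuous factor times
an integrable one). [folklore] -/
theorem integrableOn_conj_add_setIntegral_mul (hb : IntegrableOn b (Ioc a t)) (a₀ : ℂ) :
    IntegrableOn (fun s => conj (a₀ + ∫ r in Ioc a s, b r) * b s) (Ioc a t) := by
  obtain ⟨C, hC⟩ := isCompact_Icc.exists_bound_of_continuousOn (continuousOn_setIntegral_Ioc hb)
  have hcont : ContinuousOn (fun s => conj (a₀ + ∫ r in Ioc a s, b r)) (Ioc a t) :=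
    (Complex.continuous_conj.comp_continuousOn
      (continuousOn_const.add (continuousOn_setIntegral_Ioc hb))).mono Ioc_subset_Icc_self
  refine Integrable.bdd_mul (c := ‖a₀‖ + C) hb (hcont.aestronglyMeasurable measurableSet_Ioc) ?_
  filter_upwards [ae_restrict_mem measurableSet_Ioc] with s hs
  rw [Complex.norm_conj]
  exact (norm_add_le _ _).trans (by gcongr; exact hC s (Ioc_subset_Icc_self hs))

/-- Real part of the primitive: `Re ∫_{(a,s]} b = ∫_{(a,s]} Re b` for `s ≤ t`. [folklore] -/
theorem re_setIntegral_Ioc (hb : IntegrableOn b (Ioc a t)) {s : ℝ} (hs : s ≤ t) :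
    (∫ r in Ioc a s, b r).re = ∫ r in Ioc a s, (b r).re := by
  have h := integral_re (hb.mono_set (Ioc_subset_Ioc_right hs))
  simp only [RCLike.re_to_complex] at h
  exact h.symm

/-- Imaginary part of the primitive: `Im ∫_{(a,s]} b = ∫_{(a,s]} Im b` for `s ≤ t`. [folklore] -/
theorem im_setIntegral_Ioc (hb : IntegrableOn b (Ioc a t)) {s : ℝ} (hs : s ≤ t) :
    (∫ r in Ioc a s, b r).im = ∫ r in Ioc a s, (b r).im := by
  have h := integral_im (hb.mono_set (Ioc_subset_Ioc_right hs))
  simp only [RCLike.im_to_complex] at h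
  exact h.symm

/-- **Chain rule for `|primitive|²`, complex form.** For `b` integrable on `(a, t]` and `a₀ ∈ ℂ`,
`‖a₀ + ∫_{(a,t]} b‖² = ‖a₀‖² + 2 Re ∫_{(a,t]} conj(a₀ + ∫_{(a,s]} b) b(s) ds`: the identity
`|A(t)|² - |A(a)|² = 2 Re ∫ₐᵗ Ā A'` for the absolutely continuous `A(s) = a₀ + ∫_{(a,s]} b`,
proved without differentiating (real and imaginary parts are `Literature.Analysis.FunctionSpaces.sq_setIntegral_eq_two_mul`;
Temam 1984, Ch. III Lemma 1.2 is the Hilbert-space statement). [cite: Temam1984, Ch. III Lemma 1.2] -/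
theorem norm_sq_add_setIntegral_eq (hb : IntegrableOn b (Ioc a t)) (a₀ : ℂ) :
    ‖a₀ + ∫ s in Ioc a t, b s‖ ^ 2 =
      ‖a₀‖ ^ 2 + 2 * (∫ s in Ioc a t, conj (a₀ + ∫ r in Ioc a s, b r) * b s).re := by
  set B : ℝ → ℂ := fun s => ∫ r in Ioc a s, b r with hB
  have hb₁ : IntegrableOn (fun s => (b s).re) (Ioc a t) := hb.re
  have hb₂ : IntegrableOn (fun s => (b s).im) (Ioc a t) := hb.im
  have hint0 := integrableOn_conj_add_setIntegral_mul hb 0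
  simp only [zero_add] at hint0
  -- split off the constant part
  have h1 : ∫ s in Ioc a t, conj (a₀ + B s) * b s =
      conj a₀ * B t + ∫ s in Ioc a t, conj (B s) * b s := by
    have e : (fun s => conj (a₀ + B s) * b s) = fun s => conj a₀ * b s + conj (B s) * b s := by
      funext s; rw [map_add, add_mul]
    rw [e, integral_add (hb.const_mul _) hint0, integral_const_mul]
  -- the quadratic part, through real and imaginary parts
  have h2 : (∫ s in Ioc a t, conj (B s) * b s).re =
      ((∫ s in Ioc a t, (b s).re) ^ 2 + (∫ s in Ioc a t, (b s).im) ^ 2) / 2 := by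
    have hre := integral_re hint0
    simp only [RCLike.re_to_complex] at hre
    rw [← hre]
    have e : EqOn (fun s => (conj (B s) * b s).re)
        (fun s => (b s).re * (∫ r in Ioc a s, (b r).re) + (b s).im * (∫ r in Ioc a s, (b r).im))
        (Ioc a t) := by
      intro s hs
      dsimp only
      rw [Complex.mul_re, Complex.conj_re, Complex.conj_im, hB]
      dsimp only
      rw [re_setIntegral_Ioc hb hs.2, im_setIntegral_Ioc hb hs.2]
      ring
    rw [setIntegral_congr_fun measurableSet_Ioc e,
      integral_add (integrableOn_mul_setIntegral_Ioc hb₁ hb₁)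
        (integrableOn_mul_setIntegral_Ioc hb₂ hb₂)]
    have s1 := sq_setIntegral_eq_two_mul hb₁
    have s2 := sq_setIntegral_eq_two_mul hb₂
    linarith
  have h3 : ‖a₀ + B t‖ ^ 2 = ‖a₀‖ ^ 2 + 2 * (conj a₀ * B t).re + ‖B t‖ ^ 2 := by
    rw [@norm_add_sq ℝ]
    simp [Complex.mul_re]
    ring
  have h4 : ‖B t‖ ^ 2 = (∫ s in Ioc a t, (b s).re) ^ 2 + (∫ s in Ioc a t, (b s).im) ^ 2 := by
    rw [Complex.sq_norm, Complex.normSq_apply, hB]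
    dsimp only
    rw [re_setIntegral_Ioc hb le_rfl, im_setIntegral_Ioc hb le_rfl]
    ring
  rw [h3, h4, h1, Complex.add_re, h2]
  ring

end Primitive

/-! ### Functions agreeing a.e. with a primitive on `(0, T)` -/

section AE

variable {T : ℝ} {a b g : ℝ → ℂ} {a₀ : ℂ}

/-- A function that agrees a.e. on `(0,T)` with `a₀ + ∫_{(0,t]} b`, `b ∈ L¹(0,T)`, is a.e.
bounded on `(0,T)` (the primitive is continuous on `[0,T]`). [folklore] -/
theorem exists_ae_norm_le_of_ae_eq_add_setIntegral (hb : IntegrableOn b (Ioo 0 T))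
    (ha : ∀ᵐ t ∂(volume.restrict (Ioo 0 T)), a t = a₀ + ∫ s in Ioc 0 t, b s) :
    ∃ C, ∀ᵐ t ∂(volume.restrict (Ioo 0 T)), ‖a t‖ ≤ C := by
  have hb' : IntegrableOn b (Ioc 0 T) := (integrableOn_Ioc_iff_integrableOn_Ioo (by simp)).2 hb
  obtain ⟨C, hC⟩ := exists_norm_setIntegral_Ioc_le hb'
  refine ⟨‖a₀‖ + C, ?_⟩
  filter_upwards [ha, ae_restrict_mem measurableSet_Ioo] with t hat ht
  rw [hat]
  exact (norm_add_le _ _).trans (by gcongr; exact hC t (Ioo_subset_Icc_self ht))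

/-- **Chain rule for `|a|²`, a.e. form.** If `a = a₀ + ∫_{(0,·]} b` a.e. on `(0,T)` with
`b ∈ L¹(0,T; ℂ)`, then `‖a t‖² = ‖a₀‖² + 2 Re ∫_{(0,t]} conj(a) b` for a.e. `t ∈ (0,T)`
(`Literature.Analysis.FunctionSpaces.norm_sq_add_setIntegral_eq`, and `a = a₀ + ∫ b` a.e. on `(0,t] ⊆ (0,T)` inside the
integral). [cite: Temam1984, Ch. III Lemma 1.2] -/
theorem ae_norm_sq_eq_of_ae_eq_add_setIntegral (hb : IntegrableOn b (Ioo 0 T))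
    (ha : ∀ᵐ t ∂(volume.restrict (Ioo 0 T)), a t = a₀ + ∫ s in Ioc 0 t, b s) :
    ∀ᵐ t ∂(volume.restrict (Ioo 0 T)),
      ‖a t‖ ^ 2 = ‖a₀‖ ^ 2 + 2 * (∫ s in Ioc 0 t, conj (a s) * b s).re := by
  filter_upwards [ha, ae_restrict_mem measurableSet_Ioo] with t hat ht
  have hsub : Ioc 0 t ⊆ Ioo 0 T := Ioc_subset_Ioo_right ht.2
  have e : ∫ s in Ioc 0 t, conj (a₀ + ∫ r in Ioc 0 s, b r) * b s = ∫ s in Ioc 0 t, conj (a s) * b s := by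
    refine integral_congr_ae ?_
    filter_upwards [ae_restrict_of_ae_restrict_of_subset hsub ha] with s hs
    rw [hs]
  rw [hat, norm_sq_add_setIntegral_eq (hb.mono_set hsub), e]

/-- **The linearly damped integral equation: energy identity.** If `a, g ∈ L¹(0,T; ℂ)` and
`a(t) = a₀ + ∫_{(0,t]} (-λ a - g)` for a.e. `t ∈ (0,T)` (`λ ∈ ℝ`), then for a.e. `t ∈ (0,T)`,
`‖a t‖² + 2λ ∫_{(0,t]} ‖a‖² = ‖a₀‖² - 2 Re ∫_{(0,t]} conj(a) g`
(one Fourier mode of the parabolic energy equality, Temam 1984, Ch. III Lemma 1.2 /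
Evans 2010, §7.1.2 Thm. 2: `a` is automatically bounded, so all integrals converge). [cite: Temam1984, Ch. III Lemma 1.2] -/
theorem ae_norm_sq_add_eq_of_damped {lam : ℝ} (ha_int : IntegrableOn a (Ioo 0 T))
    (hg : IntegrableOn g (Ioo 0 T))
    (ha : ∀ᵐ t ∂(volume.restrict (Ioo 0 T)),
      a t = a₀ + ∫ s in Ioc 0 t, (-(lam : ℂ) * a s - g s)) :
    ∀ᵐ t ∂(volume.restrict (Ioo 0 T)),
      ‖a t‖ ^ 2 + 2 * lam * (∫ s in Ioc 0 t, ‖a s‖ ^ 2) =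
        ‖a₀‖ ^ 2 - 2 * (∫ s in Ioc 0 t, conj (a s) * g s).re := by
  have hb : IntegrableOn (fun s => -(lam : ℂ) * a s - g s) (Ioo 0 T) := (ha_int.const_mul _).sub hg
  obtain ⟨C, hC⟩ := exists_ae_norm_le_of_ae_eq_add_setIntegral hb ha
  -- `conj(a) g` and `‖a‖²` are integrable on `(0, T)`
  have hag : IntegrableOn (fun s => conj (a s) * g s) (Ioo 0 T) :=
    Integrable.bdd_mul (c := C) hg (Complex.continuous_conj.comp_aestronglyMeasurable
      ha_int.aestronglyMeasurable) (hC.mono fun s hs => by rwa [Complex.norm_conj])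
  have haa : IntegrableOn (fun s => conj (a s) * a s) (Ioo 0 T) :=
    Integrable.bdd_mul (c := C) ha_int (Complex.continuous_conj.comp_aestronglyMeasurable
      ha_int.aestronglyMeasurable) (hC.mono fun s hs => by rwa [Complex.norm_conj])
  have hsq : IntegrableOn (fun s => ‖a s‖ ^ 2) (Ioo 0 T) := by
    refine (haa.re).congr (Eventually.of_forall fun s => ?_)
    simp only [RCLike.re_to_complex]
    rw [mul_comm, Complex.mul_conj, Complex.ofReal_re, Complex.normSq_eq_norm_sq]
  filter_upwards [ae_norm_sq_eq_of_ae_eq_add_setIntegral hb ha, ae_restrict_mem measurableSet_Ioo]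
    with t ht htT
  have hsub : Ioc 0 t ⊆ Ioo 0 T := Ioc_subset_Ioo_right htT.2
  rw [ht]
  have e : (fun s => conj (a s) * (-(lam : ℂ) * a s - g s)) =
      fun s => -(lam : ℂ) * (conj (a s) * a s) - conj (a s) * g s := by
    funext s; ring
  rw [e, integral_sub ((haa.mono_set hsub).const_mul _) (hag.mono_set hsub), integral_const_mul,
    Complex.sub_re]
  have hre : (-(lam : ℂ) * ∫ s in Ioc 0 t, conj (a s) * a s).re = -lam * ∫ s in Ioc 0 t, ‖a s‖ ^ 2 := by
    have h := integral_re (haa.mono_set hsub)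
    simp only [RCLike.re_to_complex] at h
    have him : (∫ s in Ioc 0 t, conj (a s) * a s).im = 0 := by
      have h2 := integral_im (haa.mono_set hsub)
      simp only [RCLike.im_to_complex] at h2
      rw [← h2]
      refine integral_eq_zero_of_ae (Eventually.of_forall fun s => ?_)
      simp only [Pi.zero_apply]
      rw [mul_comm, Complex.mul_conj, Complex.ofReal_im]
    rw [Complex.mul_re, him, mul_zero, sub_zero, ← h]
    simp only [Complex.neg_re, Complex.ofReal_re, neg_mul]
    congr 2
    refine integral_congr_ae (Eventually.of_forall fun s => ?_)
    simp only
    rw [mul_comm, Complex.mul_conj, Complex.ofReal_re, Complex.normSq_eq_norm_sq]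
  rw [hre]
  ring

/-- **The linearly damped integral equation: dissipation bound.** Under the hypotheses of
`ae_norm_sq_add_eq_of_damped` with `λ > 0` and `g ∈ L²(0,T)`, for a.e. `t ∈ (0,T)`,
`‖a t‖² + λ ∫_{(0,t]} ‖a‖² ≤ ‖a₀‖² + λ⁻¹ ∫_{(0,t]} ‖g‖²` (Young's inequality
`2|ā g| ≤ λ|a|² + λ⁻¹|g|²` in the energy identity; Evans 2010, §7.1.2, proof of Thm. 2). [cite: Evans2010, §7.1.2 Thm. 2] -/
theorem ae_norm_sq_add_mul_setIntegral_le_of_damped {lam : ℝ} (hlam : 0 < lam)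
    (ha_int : IntegrableOn a (Ioo 0 T)) (hg : IntegrableOn g (Ioo 0 T))
    (hg2 : IntegrableOn (fun s => ‖g s‖ ^ 2) (Ioo 0 T))
    (ha : ∀ᵐ t ∂(volume.restrict (Ioo 0 T)),
      a t = a₀ + ∫ s in Ioc 0 t, (-(lam : ℂ) * a s - g s)) :
    ∀ᵐ t ∂(volume.restrict (Ioo 0 T)),
      ‖a t‖ ^ 2 + lam * (∫ s in Ioc 0 t, ‖a s‖ ^ 2) ≤
        ‖a₀‖ ^ 2 + lam⁻¹ * ∫ s in Ioc 0 t, ‖g s‖ ^ 2 := by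
  have hb : IntegrableOn (fun s => -(lam : ℂ) * a s - g s) (Ioo 0 T) := (ha_int.const_mul _).sub hg
  obtain ⟨C, hC⟩ := exists_ae_norm_le_of_ae_eq_add_setIntegral hb ha
  have hag : IntegrableOn (fun s => conj (a s) * g s) (Ioo 0 T) :=
    Integrable.bdd_mul (c := C) hg (Complex.continuous_conj.comp_aestronglyMeasurable
      ha_int.aestronglyMeasurable) (hC.mono fun s hs => by rwa [Complex.norm_conj])
  have haa : IntegrableOn (fun s => conj (a s) * a s) (Ioo 0 T) :=
    Integrable.bdd_mul (c := C) ha_int (Complex.continuous_conj.comp_aestronglyMeasurable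
      ha_int.aestronglyMeasurable) (hC.mono fun s hs => by rwa [Complex.norm_conj])
  have hsq : IntegrableOn (fun s => ‖a s‖ ^ 2) (Ioo 0 T) := by
    refine (haa.re).congr (Eventually.of_forall fun s => ?_)
    simp only [RCLike.re_to_complex]
    rw [mul_comm, Complex.mul_conj, Complex.ofReal_re, Complex.normSq_eq_norm_sq]
  filter_upwards [ae_norm_sq_add_eq_of_damped ha_int hg ha, ae_restrict_mem measurableSet_Ioo]
    with t ht htT
  have hsub : Ioc 0 t ⊆ Ioo 0 T := Ioc_subset_Ioo_right htT.2
  -- `|2 Re ∫ ā g| ≤ ∫ (λ|a|² + λ⁻¹|g|²)`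
  have hY : 2 * |(∫ s in Ioc 0 t, conj (a s) * g s).re| ≤
      lam * (∫ s in Ioc 0 t, ‖a s‖ ^ 2) + lam⁻¹ * ∫ s in Ioc 0 t, ‖g s‖ ^ 2 := by
    have h1 : |(∫ s in Ioc 0 t, conj (a s) * g s).re| ≤ ∫ s in Ioc 0 t, ‖a s‖ * ‖g s‖ := by
      refine (Complex.abs_re_le_norm _).trans ((norm_integral_le_integral_norm _).trans_eq ?_)
      refine integral_congr_ae (Eventually.of_forall fun s => ?_)
      simp only [norm_mul, Complex.norm_conj]
    have h2 : ∫ s in Ioc 0 t, 2 * (‖a s‖ * ‖g s‖) ≤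
        ∫ s in Ioc 0 t, (lam * ‖a s‖ ^ 2 + lam⁻¹ * ‖g s‖ ^ 2) := by
      refine integral_mono_of_nonneg (Eventually.of_forall fun s => by positivity)
        (((hsq.mono_set hsub).const_mul _).add ((hg2.mono_set hsub).const_mul _))
        (Eventually.of_forall fun s => ?_)
      have := two_mul_le_add_mul_sq (a := ‖a s‖) (b := ‖g s‖) hlam
      linarith
    rw [integral_const_mul, integral_add ((hsq.mono_set hsub).const_mul _)
      ((hg2.mono_set hsub).const_mul _), integral_const_mul, integral_const_mul] at h2
    linarith
  have := abs_le.1 (le_of_eq (rfl : |(∫ s in Ioc 0 t, conj (a s) * g s).re| = _))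
  have h3 := neg_abs_le (∫ s in Ioc 0 t, conj (a s) * g s).re
  nlinarith [h3, hY, ht]

end AE

end Literature.Analysis.FunctionSpaces
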